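import Literature.MathematicalPhysics.QuantumFieldTheory.Balaban1983to89.B1Eq230FluctCovPos
import Literature.MathematicalPhysics.QuantumFieldTheory.Balaban1983to89.B2Eq255Concrete

/-!
# `Balaban1983to89.HiggsCondCov232` — T. Bałaban, *(Higgs)₂,₃ quantum fields in a finite volume. I. A lower bound*,
Commun. Math. Phys. **85** (1982) 603–626 [Balaban1982Higgs1] p. 611: the conditional covariances **(2.32)**
`C^{(k)}_Λ(Ω, A) = ((aL^{−2}P(A) + Δ^{(k)}(Ω, A))↾_Λ)^{−1}`, with the restriction `A↾_Λφ = ΛAΛφ` printed there, as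
CONCRETE operators on the carriers `…HiggsLattice`/`…HiggsCovariance` for an ARBITRARY external vector field `A`,
region `Ω ⊂ T_ε`, coupling `U(A) = exp(qεeA)` and conditioning set `Λ ⊂ T^{(k)}`; their EXISTENCE (*"It is so"*,
p. 611, conditioned version: m² > 0, a > 0, L > 1, k ≤ K), symmetry, positivity; and (2.35)

statement-level skeleton of published theorems with citation tags; proofs where landed; nothing here is a claim about the Yang–Mills mass gap

PDF held: `paper:balaban1982-cmp85-higgs23-i` (journal page = PDF page + 602); pp. 608–611 [PDF 6–9] read AS IMAGES on the
×2 renders `run/shared/lean/pub/pub-balaban/b2b-balaban-ref1/pages/1982-cmp85-higgs23-I/1982-cmp85-higgs23-I-p006…p009-x2.png`.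

CITATION HEADER (lean-in-tree rule).  lit-balaban typed skeleton (HOME `run/shared/lean/pub/lit-balaban/`), typer line
(concrete carriers), gen 5; file 2 of 2 (file 1 `B1Eq230FluctCovPos`: the operator of (2.30) is symmetric positive
definite for general `A`).  SKELETON row served: **B1.Eq2.30** (owners r01/r14), members (2.32) and (2.35) — so far typed
only ABSTRACTLY (`B1RG242.StepData.Ck`, *"C^{(k)}_Λ = the same with Dirichlet conditions outside Λ"*) and, at matrix level
for the first step, in p15's `B2Eq228Conditioning` (`blkIn`, `gaussProb`); here the objects are built on the concrete
(Higgs)₂,₃ carriers for every level `k`.  NO decl of record is restated: the operator of (2.30) and `C^{(k)}(Ω,A)` ARE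
p35's `B1Eq230FluctCov.precOpA`/`fluctCovA`, the cut `Λφ` IS the typer's `B2Eq255Concrete.cutTo`/`cutToLin`.
THE SOURCE TEXT, p. 611 [PDF 9], verbatim: *"Beside the covariances (2.31), we will need the covariances which are
obtained by conditioning with respect to some set Λ ⊂ Ω^{(k)}. For an operator A defined on configurations
φ : Ω^{(k)} → R^N we define A↾_Λ as an operator on configurations φ : Λ → R^N by the formula A↾_Λφ = ΛAΛφ. We will use
the following covariances also C^{(k)}_Λ(Ω, A) = ((aL^{−2}P(A) + Δ^{(k)}(Ω, A))↾_Λ)^{−1}. (2.32) Here we will assume that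
the set Λ is a union of big blocks of T_1^{(k)}."*; Prop. 2.3: *"|C^{(k)}_Λ(Ω, A; x, x′)| ≦ c₀exp(−δ₀|x − x′|), x, x′ ∈ Λ.
(2.34) In particular the above inequality holds for C^{(k)}(Ω, A). Putting δC^{(k)}_Λ(Ω, A) = C^{(k)}_Λ(Ω, A) − C^{(k)}(Ω, A),
(2.35)"*; p. 608 [PDF 6]: *"we will write Λf and it means the product of the characteristic function Λ and the function f"*.

WHAT THIS FILE PROVES (0 sorry; standard axioms; definitions with bodies + theorems).
§1 THE RESTRICTION OF (2.32) on the concrete fields: `restrictOp Λ M = ΛMΛ` (verbatim); the padded operator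
   `padOp Λ M = ΛMΛ + (1 − Λ)` on ALL fields of `T^{(k)}` (our device, as recommended by the B1 reader r14: it agrees with
   `M↾_Λ` on the fields supported in `Λ` and is the identity on those supported in `Λᶜ`, so the inverse of `M↾_Λ` on
   `{φ : Λ → R^N}` is realised without a second carrier); `padInv = (padOp)^{−1}` (`Ring.inverse`) and
   `restrictInv Λ M = Λ(padOp Λ M)^{−1}Λ`.  PROVED: `ΛΛ = Λ`, `ΛΛᶜ = ΛᶜΛ = 0`, `Λ + Λᶜ = 1`; the quadratic form
   `⟨f,(ΛMΛ + Λᶜ)g⟩ = ⟨Λf, MΛg⟩ + ⟨Λᶜf, Λᶜg⟩`; `padOp` is positive definite — hence a unit — as soon as `M` is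
   (`siteInner_padOp_pos`, `isUnit_padOp`); `ΛMΛ·(padOp)^{−1} = Λ = (padOp)^{−1}·ΛMΛ`, `(padOp)^{−1}` commutes with `Λ`,
   and **`restrictInv` IS the two-sided inverse of `M↾_Λ` on the `Λ`-supported fields** (`restrictOp_mul_restrictInv`,
   `restrictInv_mul_restrictOp`: both products `= Λ`), vanishes off `Λ`, reads only `Λψ`, is symmetric and `≥ 0` for
   symmetric positive definite `M`.
§2 **(2.32)** `condCov232 C Ω A msq a k Λ := restrictInv Λ (precOpA C Ω A msq a k)` = `C^{(k)}_Λ(Ω, A)`;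
   `condCov232_univ` (`Λ = T^{(k)}` gives back p35's `fluctCovA` = `C^{(k)}(Ω, A)`, the member *"in particular"* of the
   family); EXISTENCE `isUnit_padOp_precOpA` and the inverse identities / symmetry / positivity with ALL hypotheses
   discharged from file 1 (m² > 0, a > 0, L > 1, k ≤ K; every `A`, `Ω`, `C`, `Λ`); **(2.35)** `deltaCov235` (`= 0` at
   `Λ = T^{(k)}`).
HONEST SCOPE.  (a) `Λ` is an arbitrary finite set of sites of `T^{(k)}` (the paper takes unions of big blocks — more
special); (b) as in p35's files the operators act on fields on ALL of `T^{(k)}` resp. `T_ε` (mass term everywhere,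
bonds outside `Ω` dropped), so for `Ω ⊊ T_ε` only m² > 0 is covered and `C^{(k)}(Ω, A)` = `fluctCovA` is the
`Λ = T^{(k)}` member of the family (2.32); (c) nothing quantitative: (2.34) and the constants `c₀, δ₀` of Prop. 2.3 are
NOT touched; (d) the Gaussian measures `dμ_{C^{(k)}_Λ}` of the conditional integrations B2 (2.28)/(2.46) are not in this
file.  Value = kernel certificates for the concrete objects B2 (2.45)/(2.46)/(2.53) and B3 (1.16) condition on; NOT
summit progress.  Unit `lit-balaban-typer` gen 5 (literature-prover-lit-balaban-typer-g5-0); HOME/FILED.md records the proposal.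
-/

open scoped BigOperators InnerProductSpace

namespace Literature.MathematicalPhysics.QuantumFieldTheory.Balaban1983to89.HiggsCondCov232

open HiggsLattice HiggsAveraging HiggsCovariance HiggsCovariancePos HiggsCovarianceCont
  HiggsFluctMeasure HiggsFluctMeasurePos HiggsFluctMeasureCov B1Eq27StepAdjoint B1Eq230FluctCov B1Eq230FluctCovPos
  B2Eq255Concrete

variable {P : HiggsLattice.Params} {N : ℕ}

/-! ## §1 The restriction `A↾_Λφ = ΛAΛφ` of (2.32) and the inverse of a restricted operator, on the concrete fields -/

section Restrict

variable {k : ℕ}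

/-- `Λ(Λψ) = Λψ` (pointwise idempotence of the cut `B2Eq255Concrete.cutTo`, p. 608). [cite: Balaban1982Higgs1, (2.32) p.611] -/
theorem cutTo_cutTo (Λ : Finset (HiggsLattice.Site P k)) (ψ : ScalarField P k N) : cutTo Λ (cutTo Λ ψ) = cutTo Λ ψ := by
  funext x
  by_cases hx : x ∈ Λ <;> simp [cutTo, hx]

/-- `ΛΛ = Λ` in the endomorphism ring: the cut `cutToLin Λ` is idempotent. [cite: Balaban1982Higgs1, (2.32) p.611] -/
theorem cutToLin_mul_self (Λ : Finset (HiggsLattice.Site P k)) :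
    (cutToLin Λ : Module.End ℝ (ScalarField P k N)) * cutToLin Λ = cutToLin Λ := by
  refine LinearMap.ext fun φ => funext fun x => ?_
  change cutTo Λ (cutTo Λ φ) x = cutTo Λ φ x
  by_cases hx : x ∈ Λ <;> simp [cutTo, hx]

/-- `ΛΛᶜ = 0`. [cite: Balaban1982Higgs1, (2.32) p.611] -/
theorem cutToLin_mul_compl (Λ : Finset (HiggsLattice.Site P k)) :
    (cutToLin Λ : Module.End ℝ (ScalarField P k N)) * cutToLin Λᶜ = 0 := by
  refine LinearMap.ext fun φ => funext fun x => ?_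
  change cutTo Λ (cutTo Λᶜ φ) x = 0
  by_cases hx : x ∈ Λ <;> simp [cutTo, hx]

/-- `ΛᶜΛ = 0`. [cite: Balaban1982Higgs1, (2.32) p.611] -/
theorem compl_mul_cutToLin (Λ : Finset (HiggsLattice.Site P k)) :
    (cutToLin Λᶜ : Module.End ℝ (ScalarField P k N)) * cutToLin Λ = 0 := by
  refine LinearMap.ext fun φ => funext fun x => ?_
  change cutTo Λᶜ (cutTo Λ φ) x = 0
  by_cases hx : x ∈ Λ <;> simp [cutTo, hx]

/-- `Λ + Λᶜ = 1` (a field is its part on `Λ` plus its part off `Λ`). [cite: Balaban1982Higgs1, (2.32) p.611] -/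
theorem cutToLin_add_compl (Λ : Finset (HiggsLattice.Site P k)) :
    (cutToLin Λ : Module.End ℝ (ScalarField P k N)) + cutToLin Λᶜ = 1 := by
  refine LinearMap.ext fun φ => funext fun x => ?_
  change cutTo Λ φ x + cutTo Λᶜ φ x = φ x
  by_cases hx : x ∈ Λ <;> simp [cutTo, hx]

/-- The cut to the whole lattice is the identity. [cite: Balaban1982Higgs1, (2.32) p.611] -/
theorem cutToLin_univ :
    (cutToLin (Finset.univ : Finset (HiggsLattice.Site P k)) : Module.End ℝ (ScalarField P k N)) = 1 :=
  LinearMap.ext fun φ => cutTo_univ φ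

/-- The cut to the empty set is zero. [cite: Balaban1982Higgs1, (2.32) p.611] -/
theorem cutToLin_empty : (cutToLin (∅ : Finset (HiggsLattice.Site P k)) : Module.End ℝ (ScalarField P k N)) = 0 := by
  refine LinearMap.ext fun φ => funext fun x => ?_
  change cutTo ∅ φ x = 0
  simp [cutTo]

/-- `⟨f, Λg⟩ = ⟨Λf, Λg⟩` for the scalar product (1.5). [cite: Balaban1982Higgs1, (1.5) p.604] -/
theorem siteInner_cutTo (Λ : Finset (HiggsLattice.Site P k)) (f g : ScalarField P k N) :
    siteInner f (cutTo Λ g) = siteInner (cutTo Λ f) (cutTo Λ g) := by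
  unfold siteInner
  refine Finset.sum_congr rfl fun x _ => ?_
  by_cases hx : x ∈ Λ <;> simp [cutTo, hx]

/-- The cut is symmetric for (1.5): `⟨f, Λg⟩ = ⟨g, Λf⟩`. [cite: Balaban1982Higgs1, (1.5) p.604] -/
theorem siteInner_cutTo_comm (Λ : Finset (HiggsLattice.Site P k)) (f g : ScalarField P k N) :
    siteInner f (cutTo Λ g) = siteInner g (cutTo Λ f) := by
  rw [siteInner_cutTo, siteInner_comm, ← siteInner_cutTo]

/-- **The restriction of (2.32)**, p. 611 verbatim: *"For an operator A defined on configurations φ : Ω^{(k)} → R^N we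
define A↾_Λ as an operator on configurations φ : Λ → R^N by the formula A↾_Λφ = ΛAΛφ"* — here on fields on all of
`T^{(k)}` (configurations on `Λ` = fields vanishing off `Λ`; `Λ` = `cutToLin Λ`). [cite: Balaban1982Higgs1, (2.32) p.611] -/
noncomputable def restrictOp (Λ : Finset (HiggsLattice.Site P k)) (M : Module.End ℝ (ScalarField P k N)) :
    Module.End ℝ (ScalarField P k N) :=
  cutToLin Λ * M * cutToLin Λ

/-- `(M↾_Λ)φ = Λ(M(Λφ))`. [cite: Balaban1982Higgs1, (2.32) p.611] -/
theorem restrictOp_apply (Λ : Finset (HiggsLattice.Site P k)) (M : Module.End ℝ (ScalarField P k N)) (φ : ScalarField P k N) :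
    restrictOp Λ M φ = cutTo Λ (M (cutTo Λ φ)) := rfl

/-- `⟨f, (M↾_Λ)g⟩ = ⟨Λf, M(Λg)⟩`. [cite: Balaban1982Higgs1, (2.32) p.611] -/
theorem siteInner_restrictOp (Λ : Finset (HiggsLattice.Site P k)) (M : Module.End ℝ (ScalarField P k N))
    (f g : ScalarField P k N) : siteInner f (restrictOp Λ M g) = siteInner (cutTo Λ f) (M (cutTo Λ g)) := by
  rw [restrictOp_apply, siteInner_cutTo_comm, siteInner_comm]

/-- `M↾_Λ` is symmetric for (1.5) when `M` is. [cite: Balaban1982Higgs1, (2.32) p.611] -/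
theorem siteInner_restrictOp_comm {M : Module.End ℝ (ScalarField P k N)}
    (hM : ∀ f g : ScalarField P k N, siteInner f (M g) = siteInner g (M f)) (Λ : Finset (HiggsLattice.Site P k))
    (f g : ScalarField P k N) : siteInner f (restrictOp Λ M g) = siteInner g (restrictOp Λ M f) := by
  rw [siteInner_restrictOp, siteInner_restrictOp, hM]

/-- **The padded operator `ΛMΛ + (1 − Λ)`** on all fields of `T^{(k)}` (our device for inverting `M↾_Λ` without a
second carrier: it is `M↾_Λ` on the fields supported in `Λ` and the identity on those supported in `Λᶜ`; `M↾_Λ` is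
invertible on `{φ : Λ → R^N}` exactly when this operator is invertible on all fields, and then
`(M↾_Λ)^{−1} = Λ(ΛMΛ + Λᶜ)^{−1}Λ` = `restrictInv`). [cite: Balaban1982Higgs1, (2.32) p.611] -/
noncomputable def padOp (Λ : Finset (HiggsLattice.Site P k)) (M : Module.End ℝ (ScalarField P k N)) :
    Module.End ℝ (ScalarField P k N) :=
  restrictOp Λ M + cutToLin Λᶜ

/-- `(ΛMΛ + Λᶜ)φ = Λ(M(Λφ)) + Λᶜφ`. [cite: Balaban1982Higgs1, (2.32) p.611] -/
theorem padOp_apply (Λ : Finset (HiggsLattice.Site P k)) (M : Module.End ℝ (ScalarField P k N)) (φ : ScalarField P k N) :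
    padOp Λ M φ = cutTo Λ (M (cutTo Λ φ)) + cutTo Λᶜ φ := rfl

/-- On the whole lattice nothing is padded: `padOp T M = M`. [cite: Balaban1982Higgs1, (2.32) p.611] -/
theorem padOp_univ (M : Module.End ℝ (ScalarField P k N)) : padOp Finset.univ M = M := by
  rw [padOp, restrictOp, cutToLin_univ, Finset.compl_univ, cutToLin_empty, one_mul, mul_one, add_zero]

/-- The bilinear form of the padded operator: `⟨f, (ΛMΛ + Λᶜ)g⟩ = ⟨Λf, M(Λg)⟩ + ⟨Λᶜf, Λᶜg⟩`.
[cite: Balaban1982Higgs1, (2.32) p.611] -/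
theorem siteInner_padOp (Λ : Finset (HiggsLattice.Site P k)) (M : Module.End ℝ (ScalarField P k N))
    (f g : ScalarField P k N) :
    siteInner f (padOp Λ M g) = siteInner (cutTo Λ f) (M (cutTo Λ g)) + siteInner (cutTo Λᶜ f) (cutTo Λᶜ g) := by
  rw [padOp, LinearMap.add_apply, siteInner_add_right, siteInner_restrictOp, cutToLin_apply, siteInner_cutTo]

/-- The padded operator is symmetric for (1.5) when `M` is. [cite: Balaban1982Higgs1, (2.32) p.611] -/
theorem siteInner_padOp_comm {M : Module.End ℝ (ScalarField P k N)}
    (hM : ∀ f g : ScalarField P k N, siteInner f (M g) = siteInner g (M f)) (Λ : Finset (HiggsLattice.Site P k))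
    (f g : ScalarField P k N) : siteInner f (padOp Λ M g) = siteInner g (padOp Λ M f) := by
  rw [siteInner_padOp, siteInner_padOp, hM, siteInner_comm (cutTo Λᶜ f)]

/-- If `Λφ = 0` then `Λᶜφ = φ`. [cite: Balaban1982Higgs1, (2.32) p.611] -/
theorem cutTo_compl_eq_self_of_cutTo_eq_zero (Λ : Finset (HiggsLattice.Site P k)) {φ : ScalarField P k N}
    (h : cutTo Λ φ = 0) : cutTo Λᶜ φ = φ := by
  funext x
  have hx0 : cutTo Λ φ x = 0 := by rw [h]; rfl
  by_cases hx : x ∈ Λ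
  · have hφx : φ x = 0 := by simpa [cutTo, hx] using hx0
    simp [cutTo, hx, hφx]
  · simp [cutTo, hx]

/-- **The padded operator is positive definite as soon as `M` is**: `0 < ⟨φ, (ΛMΛ + Λᶜ)φ⟩` for `φ ≠ 0` (if `Λφ ≠ 0`
the first term of `siteInner_padOp` is positive, otherwise `Λᶜφ = φ ≠ 0` and the second is). PROVED.
[cite: Balaban1982Higgs1, (2.32) p.611] -/
theorem siteInner_padOp_pos (Λ : Finset (HiggsLattice.Site P k)) {M : Module.End ℝ (ScalarField P k N)}
    (hM : ∀ φ : ScalarField P k N, φ ≠ 0 → 0 < siteInner φ (M φ)) {φ : ScalarField P k N} (hφ : φ ≠ 0) :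
    0 < siteInner φ (padOp Λ M φ) := by
  rw [siteInner_padOp]
  by_cases h : cutTo Λ φ = 0
  · rw [h, cutTo_compl_eq_self_of_cutTo_eq_zero Λ h, map_zero, siteInner_zero_right, zero_add]
    exact siteInner_self_pos hφ
  · have h1 := hM _ h
    have h2 := siteInner_self_nonneg (cutTo Λᶜ φ)
    linarith

/-- **`M↾_Λ` is invertible on the `Λ`-supported fields** in the form: the padded operator is a unit of the endomorphism
ring, for every positive definite `M`. PROVED. [cite: Balaban1982Higgs1, (2.32) p.611] -/
theorem isUnit_padOp (Λ : Finset (HiggsLattice.Site P k)) {M : Module.End ℝ (ScalarField P k N)}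
    (hM : ∀ φ : ScalarField P k N, φ ≠ 0 → 0 < siteInner φ (M φ)) : IsUnit (padOp Λ M) := by
  rw [LinearMap.isUnit_iff_ker_eq_bot, LinearMap.ker_eq_bot']
  intro φ hφ0
  by_contra hne
  have h := siteInner_padOp_pos Λ hM hne
  rw [hφ0, siteInner_zero_right] at h
  exact lt_irrefl _ h

/-- The inverse of the padded operator (`Ring.inverse`; junk `0` when not a unit). [cite: Balaban1982Higgs1, (2.32) p.611] -/
noncomputable def padInv (Λ : Finset (HiggsLattice.Site P k)) (M : Module.End ℝ (ScalarField P k N)) :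
    Module.End ℝ (ScalarField P k N) :=
  Ring.inverse (padOp Λ M)

/-- **`(M↾_Λ)^{−1}` as an operator on all fields of `T^{(k)}`**: `Λ(ΛMΛ + Λᶜ)^{−1}Λ` (zero off `Λ`, reads only the part
of its argument on `Λ`). [cite: Balaban1982Higgs1, (2.32) p.611] -/
noncomputable def restrictInv (Λ : Finset (HiggsLattice.Site P k)) (M : Module.End ℝ (ScalarField P k N)) :
    Module.End ℝ (ScalarField P k N) :=
  cutToLin Λ * padInv Λ M * cutToLin Λ

/-- `restrictInv Λ M = (padInv Λ M)↾_Λ` (definitional). [cite: Balaban1982Higgs1, (2.32) p.611] -/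
theorem restrictInv_eq_restrictOp (Λ : Finset (HiggsLattice.Site P k)) (M : Module.End ℝ (ScalarField P k N)) :
    restrictInv Λ M = restrictOp Λ (padInv Λ M) := rfl

/-- `(M↾_Λ)^{−1}ψ = Λ((ΛMΛ + Λᶜ)^{−1}(Λψ))`. [cite: Balaban1982Higgs1, (2.32) p.611] -/
theorem restrictInv_apply (Λ : Finset (HiggsLattice.Site P k)) (M : Module.End ℝ (ScalarField P k N))
    (ψ : ScalarField P k N) : restrictInv Λ M ψ = cutTo Λ (padInv Λ M (cutTo Λ ψ)) := rfl

/-- `(M↾_Λ)^{−1}ψ` vanishes off `Λ` (it is a configuration on `Λ`). [cite: Balaban1982Higgs1, (2.32) p.611] -/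
theorem restrictInv_apply_of_not_mem (Λ : Finset (HiggsLattice.Site P k)) (M : Module.End ℝ (ScalarField P k N))
    (ψ : ScalarField P k N) {x : HiggsLattice.Site P k} (hx : x ∉ Λ) : restrictInv Λ M ψ x = 0 := by
  rw [restrictInv_apply]
  exact cutTo_of_not_mem Λ _ hx

/-- `(M↾_Λ)^{−1}` reads only `Λψ`: `(M↾_Λ)^{−1}(Λψ) = (M↾_Λ)^{−1}ψ`. [cite: Balaban1982Higgs1, (2.32) p.611] -/
theorem restrictInv_cutTo (Λ : Finset (HiggsLattice.Site P k)) (M : Module.End ℝ (ScalarField P k N))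
    (ψ : ScalarField P k N) : restrictInv Λ M (cutTo Λ ψ) = restrictInv Λ M ψ := by
  rw [restrictInv_apply, restrictInv_apply, cutTo_cutTo]

variable (Λ : Finset (HiggsLattice.Site P k)) (M : Module.End ℝ (ScalarField P k N))

/-- `(ΛMΛ + Λᶜ)(ΛMΛ + Λᶜ)^{−1} = 1` when the padded operator is a unit. [cite: Balaban1982Higgs1, (2.32) p.611] -/
theorem padOp_mul_padInv (hU : IsUnit (padOp Λ M)) : padOp Λ M * padInv Λ M = 1 :=
  Ring.mul_inverse_cancel _ hU

/-- `(ΛMΛ + Λᶜ)^{−1}(ΛMΛ + Λᶜ) = 1` when the padded operator is a unit. [cite: Balaban1982Higgs1, (2.32) p.611] -/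
theorem padInv_mul_padOp (hU : IsUnit (padOp Λ M)) : padInv Λ M * padOp Λ M = 1 :=
  Ring.inverse_mul_cancel _ hU

/-- Applied form: `(ΛMΛ + Λᶜ)((ΛMΛ + Λᶜ)^{−1}ψ) = ψ`. [cite: Balaban1982Higgs1, (2.32) p.611] -/
theorem padOp_padInv_apply (hU : IsUnit (padOp Λ M)) (ψ : ScalarField P k N) : padOp Λ M (padInv Λ M ψ) = ψ := by
  have h := congrArg (fun T : Module.End ℝ (ScalarField P k N) => T ψ) (padOp_mul_padInv Λ M hU)
  simpa using h

/-- `Λ(ΛMΛ + Λᶜ) = ΛMΛ`. [cite: Balaban1982Higgs1, (2.32) p.611] -/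
theorem cutToLin_mul_padOp : (cutToLin Λ : Module.End ℝ (ScalarField P k N)) * padOp Λ M = restrictOp Λ M := by
  rw [padOp, restrictOp, mul_add, cutToLin_mul_compl, add_zero, ← mul_assoc, ← mul_assoc, cutToLin_mul_self]

/-- `(ΛMΛ + Λᶜ)Λ = ΛMΛ`. [cite: Balaban1982Higgs1, (2.32) p.611] -/
theorem padOp_mul_cutToLin : padOp Λ M * (cutToLin Λ : Module.End ℝ (ScalarField P k N)) = restrictOp Λ M := by
  rw [padOp, restrictOp, add_mul, compl_mul_cutToLin, add_zero, mul_assoc, cutToLin_mul_self]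

/-- **`(M↾_Λ)·(ΛMΛ + Λᶜ)^{−1} = Λ`**. [cite: Balaban1982Higgs1, (2.32) p.611] -/
theorem restrictOp_mul_padInv (hU : IsUnit (padOp Λ M)) :
    restrictOp Λ M * padInv Λ M = (cutToLin Λ : Module.End ℝ (ScalarField P k N)) := by
  rw [← cutToLin_mul_padOp, mul_assoc, padOp_mul_padInv Λ M hU, mul_one]

/-- **`(ΛMΛ + Λᶜ)^{−1}·(M↾_Λ) = Λ`**. [cite: Balaban1982Higgs1, (2.32) p.611] -/
theorem padInv_mul_restrictOp (hU : IsUnit (padOp Λ M)) :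
    padInv Λ M * restrictOp Λ M = (cutToLin Λ : Module.End ℝ (ScalarField P k N)) := by
  rw [← padOp_mul_cutToLin, ← mul_assoc, padInv_mul_padOp Λ M hU, one_mul]

/-- The padded inverse commutes with the cut: `(ΛMΛ + Λᶜ)^{−1}Λ = Λ(ΛMΛ + Λᶜ)^{−1}` (it is block-diagonal for
`Λ ⊕ Λᶜ`). [cite: Balaban1982Higgs1, (2.32) p.611] -/
theorem padInv_mul_cutToLin_comm (hU : IsUnit (padOp Λ M)) :
    padInv Λ M * (cutToLin Λ : Module.End ℝ (ScalarField P k N)) = cutToLin Λ * padInv Λ M := by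
  calc padInv Λ M * (cutToLin Λ : Module.End ℝ (ScalarField P k N))
      = padInv Λ M * (restrictOp Λ M * padInv Λ M) := by rw [restrictOp_mul_padInv Λ M hU]
    _ = (padInv Λ M * restrictOp Λ M) * padInv Λ M := by rw [mul_assoc]
    _ = cutToLin Λ * padInv Λ M := by rw [padInv_mul_restrictOp Λ M hU]

/-- `(M↾_Λ)^{−1} = Λ(ΛMΛ + Λᶜ)^{−1} = (ΛMΛ + Λᶜ)^{−1}Λ`. [cite: Balaban1982Higgs1, (2.32) p.611] -/
theorem restrictInv_eq (hU : IsUnit (padOp Λ M)) :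
    restrictInv Λ M = cutToLin Λ * padInv Λ M ∧ restrictInv Λ M = padInv Λ M * cutToLin Λ := by
  have h1 : restrictInv Λ M = cutToLin Λ * padInv Λ M := by
    rw [restrictInv, mul_assoc, padInv_mul_cutToLin_comm Λ M hU, ← mul_assoc, cutToLin_mul_self]
  exact ⟨h1, by rw [h1, padInv_mul_cutToLin_comm Λ M hU]⟩

/-- **`(M↾_Λ)·(M↾_Λ)^{−1} = Λ`** — the identity of the configurations on `Λ`: `restrictInv` is a right inverse of the
restricted operator of (2.32) on the `Λ`-supported fields. PROVED. [cite: Balaban1982Higgs1, (2.32) p.611] -/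
theorem restrictOp_mul_restrictInv (hU : IsUnit (padOp Λ M)) :
    restrictOp Λ M * restrictInv Λ M = (cutToLin Λ : Module.End ℝ (ScalarField P k N)) := by
  rw [(restrictInv_eq Λ M hU).2, ← mul_assoc, restrictOp_mul_padInv Λ M hU, cutToLin_mul_self]

/-- **`(M↾_Λ)^{−1}·(M↾_Λ) = Λ`** — `restrictInv` is a left inverse of the restricted operator on the `Λ`-supported
fields. PROVED. [cite: Balaban1982Higgs1, (2.32) p.611] -/
theorem restrictInv_mul_restrictOp (hU : IsUnit (padOp Λ M)) :
    restrictInv Λ M * restrictOp Λ M = (cutToLin Λ : Module.End ℝ (ScalarField P k N)) := by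
  rw [(restrictInv_eq Λ M hU).1, mul_assoc, padInv_mul_restrictOp Λ M hU, cutToLin_mul_self]

/-- Applied form: `(M↾_Λ)((M↾_Λ)^{−1}ψ) = Λψ`. [cite: Balaban1982Higgs1, (2.32) p.611] -/
theorem restrictOp_restrictInv_apply (hU : IsUnit (padOp Λ M)) (ψ : ScalarField P k N) :
    restrictOp Λ M (restrictInv Λ M ψ) = cutTo Λ ψ := by
  have h := congrArg (fun T : Module.End ℝ (ScalarField P k N) => T ψ) (restrictOp_mul_restrictInv Λ M hU)
  simpa [cutToLin_apply] using h

/-- Applied form: `(M↾_Λ)^{−1}((M↾_Λ)φ) = Λφ`. [cite: Balaban1982Higgs1, (2.32) p.611] -/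
theorem restrictInv_restrictOp_apply (hU : IsUnit (padOp Λ M)) (φ : ScalarField P k N) :
    restrictInv Λ M (restrictOp Λ M φ) = cutTo Λ φ := by
  have h := congrArg (fun T : Module.End ℝ (ScalarField P k N) => T φ) (restrictInv_mul_restrictOp Λ M hU)
  simpa [cutToLin_apply] using h

/-- The padded inverse is symmetric for (1.5) when `M` is. [cite: Balaban1982Higgs1, (2.32) p.611] -/
theorem siteInner_padInv_comm (hM : ∀ f g : ScalarField P k N, siteInner f (M g) = siteInner g (M f))
    (f g : ScalarField P k N) : siteInner f (padInv Λ M g) = siteInner g (padInv Λ M f) :=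
  siteInner_inverse_comm _ (siteInner_padOp_comm hM Λ) f g

/-- **`(M↾_Λ)^{−1}` is symmetric** for (1.5) when `M` is. [cite: Balaban1982Higgs1, (2.32) p.611] -/
theorem siteInner_restrictInv_comm (hM : ∀ f g : ScalarField P k N, siteInner f (M g) = siteInner g (M f))
    (f g : ScalarField P k N) : siteInner f (restrictInv Λ M g) = siteInner g (restrictInv Λ M f) := by
  rw [restrictInv_eq_restrictOp]
  exact siteInner_restrictOp_comm (siteInner_padInv_comm Λ M hM) Λ f g

/-- **`(M↾_Λ)^{−1} > 0` on the configurations on `Λ`** for positive definite `M`: `0 < ⟨ψ, (M↾_Λ)^{−1}ψ⟩` whenever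
`Λψ ≠ 0`. PROVED. [cite: Balaban1982Higgs1, (2.32) p.611] -/
theorem siteInner_restrictInv_pos (hpos : ∀ φ : ScalarField P k N, φ ≠ 0 → 0 < siteInner φ (M φ))
    {ψ : ScalarField P k N} (hψ : cutTo Λ ψ ≠ 0) : 0 < siteInner ψ (restrictInv Λ M ψ) := by
  have hU := isUnit_padOp Λ hpos
  have hsol : padOp Λ M (padInv Λ M (cutTo Λ ψ)) = cutTo Λ ψ := padOp_padInv_apply Λ M hU (cutTo Λ ψ)
  have h0 : padInv Λ M (cutTo Λ ψ) ≠ 0 := by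
    intro h
    apply hψ
    rw [← hsol, h, map_zero]
  rw [restrictInv_eq_restrictOp, siteInner_restrictOp]
  have hq : siteInner (cutTo Λ ψ) (padInv Λ M (cutTo Λ ψ))
      = siteInner (padInv Λ M (cutTo Λ ψ)) (padOp Λ M (padInv Λ M (cutTo Λ ψ))) := by
    rw [hsol, siteInner_comm]
  rw [hq]
  exact siteInner_padOp_pos Λ hpos h0

/-- **`(M↾_Λ)^{−1} ≥ 0`** for positive definite `M`: `0 ≤ ⟨ψ, (M↾_Λ)^{−1}ψ⟩` for every `ψ` (it reads only `Λψ`).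
PROVED. [cite: Balaban1982Higgs1, (2.32) p.611] -/
theorem siteInner_restrictInv_nonneg (hpos : ∀ φ : ScalarField P k N, φ ≠ 0 → 0 < siteInner φ (M φ))
    (ψ : ScalarField P k N) : 0 ≤ siteInner ψ (restrictInv Λ M ψ) := by
  by_cases hψ : cutTo Λ ψ = 0
  · rw [← restrictInv_cutTo, hψ, map_zero, siteInner_zero_right]
  · exact (siteInner_restrictInv_pos Λ M hpos hψ).le

end Restrict

/-! ## §2 (2.32): `C^{(k)}_Λ(Ω, A)` for the concrete model; existence; (2.35) -/

section CondCov

variable (C : ChargeData N) (Ω : Finset (HiggsLattice.Site P 0)) (A : HiggsLattice.VecField P 0) (msq a : ℝ)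

/-- **(2.32)** p. 611, verbatim: *"C^{(k)}_Λ(Ω, A) = ((aL^{−2}P(A) + Δ^{(k)}(Ω, A))↾_Λ)^{−1}. (2.32)"* — the conditional
covariance of the CONCRETE model at level `k` for the conditioning set `Λ ⊂ T^{(k)}`: the inverse, on the
configurations supported in `Λ`, of the restriction `Λ(a(L^{k+1}ε)^{−2}P(A) + Δ^{(k),L^kε}(Ω,A))Λ` of p35's operator
`B1Eq230FluctCov.precOpA` (realised as `restrictInv`; written on the `L^kε`-lattice — the unit-lattice letters `aL^{−2}`,
`Δ^{(k)}` of the print are the same objects after the rescaling (2.22)/(2.31), `B1Eq230FluctCovPos.precOpA_unitAt`).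
[cite: Balaban1982Higgs1, (2.32) p.611] -/
noncomputable def condCov232 (k : ℕ) (Λ : Finset (HiggsLattice.Site P k)) : Module.End ℝ (ScalarField P k N) :=
  restrictInv Λ (precOpA C Ω A msq a k)

/-- **`Λ = T^{(k)}` gives back (2.30)/(2.31)**: `C^{(k)}_{T^{(k)}}(Ω, A) = C^{(k)}(Ω, A)` = p35's `fluctCovA` (p. 611: *"In
particular the above inequality holds for C^{(k)}(Ω, A)"* — the unconditioned covariance is the member `Λ = everything`
of the family). [cite: Balaban1982Higgs1, (2.32) p.611] -/
theorem condCov232_univ (k : ℕ) : condCov232 C Ω A msq a k Finset.univ = fluctCovA C Ω A msq a k := by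
  rw [condCov232, restrictInv, padInv, padOp_univ, cutToLin_univ, one_mul, mul_one]
  rfl

/-- `C^{(k)}_Λ(Ω,A)ψ` vanishes off `Λ`. [cite: Balaban1982Higgs1, (2.32) p.611] -/
theorem condCov232_apply_of_not_mem (k : ℕ) (Λ : Finset (HiggsLattice.Site P k)) (ψ : ScalarField P k N)
    {x : HiggsLattice.Site P k} (hx : x ∉ Λ) : condCov232 C Ω A msq a k Λ ψ x = 0 :=
  restrictInv_apply_of_not_mem Λ _ ψ hx

/-- `C^{(k)}_Λ(Ω,A)(Λψ) = C^{(k)}_Λ(Ω,A)ψ`. [cite: Balaban1982Higgs1, (2.32) p.611] -/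
theorem condCov232_cutTo (k : ℕ) (Λ : Finset (HiggsLattice.Site P k)) (ψ : ScalarField P k N) :
    condCov232 C Ω A msq a k Λ (cutTo Λ ψ) = condCov232 C Ω A msq a k Λ ψ :=
  restrictInv_cutTo Λ _ ψ

/-- **EXISTENCE of (2.32) for the concrete model** (*"It is so"*, p. 611, conditioned version): the padded restriction
`Λ(a(L^{k+1}ε)^{−2}P(A) + Δ^{(k)}(Ω,A))Λ + Λᶜ` is a unit — m² > 0, a > 0, L > 1, k ≤ K; EVERY `A`, `Ω`, `C`, `Λ`
(`B1Eq230FluctCovPos.siteInner_precOpA_pos`). PROVED. [cite: Balaban1982Higgs1, (2.32) p.611] -/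
theorem isUnit_padOp_precOpA {msq a : ℝ} (hmsq : 0 < msq) (ha : 0 < a) (hL : 1 < (P.L : ℝ)) {k : ℕ} (hk : k ≤ P.K)
    (Λ : Finset (HiggsLattice.Site P k)) : IsUnit (padOp Λ (precOpA C Ω A msq a k : Module.End ℝ (ScalarField P k N))) :=
  isUnit_padOp Λ fun _ hφ => siteInner_precOpA_pos C Ω A hmsq ha hL hk hφ

/-- **`((aL^{−2}P(A) + Δ^{(k)}(Ω,A))↾_Λ) · C^{(k)}_Λ(Ω,A) = Λ`** (= the identity on the configurations on `Λ`), hypotheses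
discharged. PROVED. [cite: Balaban1982Higgs1, (2.32) p.611] -/
theorem restrictOp_precOpA_mul_condCov232 {msq a : ℝ} (hmsq : 0 < msq) (ha : 0 < a) (hL : 1 < (P.L : ℝ)) {k : ℕ}
    (hk : k ≤ P.K) (Λ : Finset (HiggsLattice.Site P k)) :
    restrictOp Λ (precOpA C Ω A msq a k) * condCov232 C Ω A msq a k Λ
      = (cutToLin Λ : Module.End ℝ (ScalarField P k N)) :=
  restrictOp_mul_restrictInv Λ _ (isUnit_padOp_precOpA C Ω A hmsq ha hL hk Λ)

/-- **`C^{(k)}_Λ(Ω,A) · ((aL^{−2}P(A) + Δ^{(k)}(Ω,A))↾_Λ) = Λ`**, hypotheses discharged. PROVED.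
[cite: Balaban1982Higgs1, (2.32) p.611] -/
theorem condCov232_mul_restrictOp_precOpA {msq a : ℝ} (hmsq : 0 < msq) (ha : 0 < a) (hL : 1 < (P.L : ℝ)) {k : ℕ}
    (hk : k ≤ P.K) (Λ : Finset (HiggsLattice.Site P k)) :
    condCov232 C Ω A msq a k Λ * restrictOp Λ (precOpA C Ω A msq a k)
      = (cutToLin Λ : Module.End ℝ (ScalarField P k N)) :=
  restrictInv_mul_restrictOp Λ _ (isUnit_padOp_precOpA C Ω A hmsq ha hL hk Λ)

/-- Applied form: `((aL^{−2}P(A) + Δ^{(k)}(Ω,A))↾_Λ)(C^{(k)}_Λ(Ω,A)ψ) = Λψ`. [cite: Balaban1982Higgs1, (2.32) p.611] -/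
theorem restrictOp_precOpA_condCov232_apply {msq a : ℝ} (hmsq : 0 < msq) (ha : 0 < a) (hL : 1 < (P.L : ℝ)) {k : ℕ}
    (hk : k ≤ P.K) (Λ : Finset (HiggsLattice.Site P k)) (ψ : ScalarField P k N) :
    restrictOp Λ (precOpA C Ω A msq a k) (condCov232 C Ω A msq a k Λ ψ) = cutTo Λ ψ :=
  restrictOp_restrictInv_apply Λ _ (isUnit_padOp_precOpA C Ω A hmsq ha hL hk Λ) ψ

/-- Applied form: `C^{(k)}_Λ(Ω,A)(((aL^{−2}P(A) + Δ^{(k)}(Ω,A))↾_Λ)φ) = Λφ`. [cite: Balaban1982Higgs1, (2.32) p.611] -/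
theorem condCov232_restrictOp_precOpA_apply {msq a : ℝ} (hmsq : 0 < msq) (ha : 0 < a) (hL : 1 < (P.L : ℝ)) {k : ℕ}
    (hk : k ≤ P.K) (Λ : Finset (HiggsLattice.Site P k)) (φ : ScalarField P k N) :
    condCov232 C Ω A msq a k Λ (restrictOp Λ (precOpA C Ω A msq a k) φ) = cutTo Λ φ :=
  restrictInv_restrictOp_apply Λ _ (isUnit_padOp_precOpA C Ω A hmsq ha hL hk Λ) φ

/-- **`C^{(k)}_Λ(Ω, A)` is symmetric** for (1.5). [cite: Balaban1982Higgs1, (2.32) p.611] -/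
theorem siteInner_condCov232_comm (k : ℕ) (Λ : Finset (HiggsLattice.Site P k)) (f g : ScalarField P k N) :
    siteInner f (condCov232 C Ω A msq a k Λ g) = siteInner g (condCov232 C Ω A msq a k Λ f) :=
  siteInner_restrictInv_comm Λ _ (siteInner_precOpA_comm C Ω A msq a k) f g

/-- **`C^{(k)}_Λ(Ω, A) ≥ 0`**: `0 ≤ ⟨ψ, C^{(k)}_Λ(Ω,A)ψ⟩` (m² > 0, a > 0, L > 1, k ≤ K). PROVED. [cite: Balaban1982Higgs1, (2.32) p.611] -/
theorem siteInner_condCov232_nonneg {msq a : ℝ} (hmsq : 0 < msq) (ha : 0 < a) (hL : 1 < (P.L : ℝ)) {k : ℕ}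
    (hk : k ≤ P.K) (Λ : Finset (HiggsLattice.Site P k)) (ψ : ScalarField P k N) :
    0 ≤ siteInner ψ (condCov232 C Ω A msq a k Λ ψ) :=
  siteInner_restrictInv_nonneg Λ _ (fun _ hφ => siteInner_precOpA_pos C Ω A hmsq ha hL hk hφ) ψ

/-- **`C^{(k)}_Λ(Ω, A) > 0` on the configurations on `Λ`**: `0 < ⟨ψ, C^{(k)}_Λ(Ω,A)ψ⟩` whenever `Λψ ≠ 0` (m² > 0,
a > 0, L > 1, k ≤ K). PROVED. [cite: Balaban1982Higgs1, (2.32) p.611] -/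
theorem siteInner_condCov232_pos {msq a : ℝ} (hmsq : 0 < msq) (ha : 0 < a) (hL : 1 < (P.L : ℝ)) {k : ℕ}
    (hk : k ≤ P.K) (Λ : Finset (HiggsLattice.Site P k)) {ψ : ScalarField P k N} (hψ : cutTo Λ ψ ≠ 0) :
    0 < siteInner ψ (condCov232 C Ω A msq a k Λ ψ) :=
  siteInner_restrictInv_pos Λ _ (fun _ hφ => siteInner_precOpA_pos C Ω A hmsq ha hL hk hφ) hψ

/-- **(2.35)** p. 611, verbatim: *"Putting δC^{(k)}_Λ(Ω, A) = C^{(k)}_Λ(Ω, A) − C^{(k)}(Ω, A), (2.35)"* — for the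
concrete model (`C^{(k)}(Ω,A)` = p35's `fluctCovA`). [cite: Balaban1982Higgs1, (2.35) p.611] -/
noncomputable def deltaCov235 (k : ℕ) (Λ : Finset (HiggsLattice.Site P k)) : Module.End ℝ (ScalarField P k N) :=
  condCov232 C Ω A msq a k Λ - fluctCovA C Ω A msq a k

/-- `δC^{(k)}_{T^{(k)}}(Ω, A) = 0` (no conditioning). [cite: Balaban1982Higgs1, (2.35) p.611] -/
theorem deltaCov235_univ (k : ℕ) : deltaCov235 C Ω A msq a k Finset.univ = 0 := by
  rw [deltaCov235, condCov232_univ, sub_self]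

/-- `δC^{(k)}_Λ(Ω, A)` is symmetric for (1.5) (difference of two symmetric operators). [cite: Balaban1982Higgs1, (2.35) p.611] -/
theorem siteInner_deltaCov235_comm (k : ℕ) (Λ : Finset (HiggsLattice.Site P k)) (f g : ScalarField P k N) :
    siteInner f (deltaCov235 C Ω A msq a k Λ g) = siteInner g (deltaCov235 C Ω A msq a k Λ f) := by
  rw [deltaCov235, LinearMap.sub_apply, LinearMap.sub_apply, siteInner_sub_right, siteInner_sub_right,
    siteInner_condCov232_comm, siteInner_fluctCovA_comm]

end CondCov

end Literature.MathematicalPhysics.QuantumFieldTheory.Balaban1983to89.HiggsCondCov232
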